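import Summits.HubbardSuperconductivity.HubbardSuperconductivity.Theses.SeamInduction

/-!
# `Lines/column_factorisation.lean` — strategist line for crux `WidthHaldaneBridge`
(stmt-HubbardSuperconductivity-16311; rank-2 crux of route `WidthHaldane`, rank-4 shared crux of route `SeamInduction`,
sub `HubbardSuperconductivity`)

Strategist `planner-cstrat-stmt-HubbardSuperconductivity-16311-b1-0`, 2026-08-17 (mode crux-strategist; the crux is FIXED —
decl and signature are the route's; this file concludes it BY NAME). Companion card: `Lines/column_factorisation.md`;
strategy census: `STRATEGY-CENSUS.md` in the same crux directory.

## The cut (why this is not `birth`)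

`birth` cuts the crux ACROSS WIDTHS (per-width law with free constants + seam gluing of two DIFFERENT tubes, climbed by a
proved induction). Its lead (PICKED.md, c4–c10) recorded the stuck point: the gluing stub compares ground states of different
Hamiltonians on different graphs and "gives no operator-theoretic handle on the glued tube"; both stubs are conjecture
strength. This line cuts the SAME crux ORTHOGONALLY, inside ONE tube and ONE ground state, along the displacement `r`:

* at `r = 0` the column correlator is a sum of squared norms, `G_ψ(0) = Σ_a ‖Φ_a ψ‖²`, and the crux's amplitude
  normalisation `A·L·M²` (against the trivial local scale `L·M`) is ALREADY an order statement: `Σ_a ‖Φ_a ψ‖² ≍ L·M²`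
  says the `M` rung pair fields of one column add COHERENTLY, i.e. the transverse relative pair phases are locked across
  the whole circumference `M ≤ L` (the "C1" half of Luther–Emery C1S0; at `M = L` it is pair coherence along every column
  of the square torus). This is `stub_transverseCoherence` (predicate `ColumnWeight`): EXPONENT-FREE.
* for `r ≠ 0` what remains is the SHAPE of the decay relative to the equal-column weight:
  `G_ψ(r) ≥ a · G_ψ(0) · r̂^{−Ξ√(ẽ″/ρ̃)/M}` — the Haldane-form power law for the NORMALISED correlator `G_ψ(r)/G_ψ(0) ∈
  [−1, 1]` (Cauchy–Schwarz), in which the non-universal amplitude has been divided out; Luther–Emery universality predicts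
  `Ξ = 2/π` exactly in the crux's normalisation (`K = π√(D_p κ_p) = (π/4)·M√(ρ̃/ẽ″)`, pair exponent `1/(2K)`), so `Ξ` is
  uniform in the width for free and only the O(1) relative constant `a` and the thresholds carry width-uniformity.
  This is `stub_relativeColumnLaw` (predicate `RelativeLaw`): AMPLITUDE-FREE, single tube, single state, no gluing.

The composition `WidthHaldaneBridge_of_stubs : stub_T-statement → stub_L-statement → <crux verbatim>` is two lines of real
arithmetic (`core_factor`: `A₀LM² ≤ G(0)` and `a·G(0)·x ≤ G(r)` with `a, x ≥ 0` give `(a·A₀)·L·M²·x ≤ G(r)`), so the seam is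
trivial by design (`trivial_seam`); neither factor is the crux: `ColumnWeight` says nothing about `r ≠ 0`, `RelativeLaw`
nothing about the absolute size of `G` (both are CONSEQUENCES of the crux — `G(0) ≥ G(r)` and the kinematic ceiling
`G(0) ≤ c·L·M²` — so the cut is a genuine factorisation `Crux ⟺ T ∧ L` up to constants, not a strengthening).

## Stubs (sorries live ONLY here)

* `stub_transverseCoherence` — EQUAL-COLUMN TRANSVERSE PAIR COHERENCE: under `UniformThermo`, beyond a width floor `M₂`
  and a length floor `L₁`, every normalised sector ground state of every even tube has `Σ_a ‖Φ_a ψ‖² ≥ A₀·L·M²` with ONE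
  `A₀ > 0` for all widths `M₂ ≤ M ≤ L`. Why plausibly true: stiff + compressible tube ⇒ one gapless total-charge mode, all
  RELATIVE transverse charge/phase modes gapped (C1S0 flow of N-leg Hubbard ladders [LinBalentsFisher1997]; 2-leg numerics
  [NoackWhiteScalapino1996, DolfiEtAl2015]) ⇒ at equal time the rung pair fields of a column share one phase, `‖Σ_b P_(a,b) ψ‖²
  ≍ M²·|ᾱ|²`; width-uniformity of `A₀` up to `M = L` is the statement that the 2D d-wave order parameter of the witness
  point is non-zero (the 2D germ of the crux, isolated at `r = 0` where no exponent enters). Why it might fail: the crux's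
  own failure modes (CEX `q_y = π` or triplet condensate with uniform thermodynamics ⇒ `G(0) ≍ L·M` only), cofinally in `M`.
  Size XL / conjecture-strength (at `M = L` it is column-summed pair coherence on the square torus).
* `stub_relativeColumnLaw` — AMPLITUDE-FREE LUTHER–EMERY LAW: under `UniformThermo` there are `Ξ, a > 0` and thresholds
  `R, M₂, L₁` such that every normalised sector ground state of every even tube obeys
  `a · G_ψ(0) · r̂^{−Ξ√(ẽ″_{L,M}/ρ̃_{L,M})/M} ≤ G_ψ(r)` for `R ≤ r̂`. Why plausibly true: the thermodynamic Luttinger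
  number of the single charge mode is `K = (π/4)·M√(ρ̃/ẽ″)` (twist stiffness `D_p = ρ̃M/4`, pair compressibility
  `κ_p = M/(4ẽ″)`, `K = π√(D_p κ_p)`), and the normalised pair correlator of a Luther–Emery liquid decays EXACTLY as
  `r̂^{−1/(2K)} = r̂^{−(2/π)/K̂}` [Haldane1981; proved Haldane relations for spinless chains: BenfattoFalcoMastropietro2010,
  BenfattoMastropietro2011; LL structure of the Hubbard chain: Mastropietro2005; `ν·μ = 1` on the 2-leg ladder:
  DolfiEtAl2015] — so `Ξ = 1 > 2/π` is uniform in the width by UNIVERSALITY, not by gluing, and `a ≈ (1 + c/(M|ᾱ|²))⁻¹`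
  is O(1) once `M ≥ M₂(U,δ)`. Why it might fail: a width family that is stiff and compressible but not C1S0 in the `q_y = 0`
  singlet channel (C1Sn, CEX) has `G(0) ≍ LM > 0` with exponentially decaying or sign-changing `G(r)`; thresholds `R, L₁` may
  grow with the width at weak `U` (`L₁ ~ ξ_M`). Size XL / conjecture-strength per width (constructive multiband RG with Ward
  identities), but with NO dimensional crossover and NO amplitude inside it.

Disproof used: none relevant — no `Disproof.lean` / `Negative/` lemma exists for this crux (crux dir: birth + PICKED only,
2026-08-17); the summit's negatives index (stmt-1180 BreathingSelfDual at L = 2, stmt-1314 KlsOrderOpenness) does not touch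
tubes, column pair fields or thermodynamic Luttinger numbers. Refuter rattack (2026-08-17T05:05Z) vetted the crux text this
file copies verbatim (ℕ-subtractions safe, rpow base ≥ R, quantifier order = informal).
-/

namespace Summit.HubbardSuperconductivity.HubbardSuperconductivity.Cruxes.WidthHaldaneBridge.ColumnFactorisation

open scoped BigOperators Topology Manifold Classical MeasureTheory ProbabilityTheory Matrix InnerProductSpace ComplexConjugate ContinuousMap
open Filter Set Function TopologicalSpace MeasureTheory
open Literature.Hubbard
open Summit.HubbardSuperconductivity.HubbardSuperconductivity.Theses.WidthHaldane (WidthHaldaneBridge)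

/-- The crux's HYPOTHESIS (verbatim slice, identical to `Lines/birth.lean`): width-uniform twist stiffness per site
`d₀ ≤ ρ̃_{L,M}(U,δ)` and inverse pair compressibility `0 < ẽ″_{L,M}(U,δ) ≤ k₀` of the pure Hubbard tubes, all even
`M₁ ≤ M ≤ L`, `L ≥ L₀`, every linearly ordered labelling `e : Λ ≃ ℤ/L × ℤ/M`. -/
def UniformThermo (U δ d₀ k₀ : ℝ) (M₁ L₀ : ℕ) : Prop :=
  open Matrix Literature.MathematicalPhysics.QuantumLattice in let H0 : ∀ (L M : ℕ) (Λ : Type) [LinearOrder Λ] [Fintype Λ], (Λ ≃ ZMod L × ZMod M) → ℝ → Matrix (Finset (Orb Λ)) (Finset (Orb Λ)) ℂ := fun _ _ Λ _ _ e U => hamiltonian (SimpleGraph.fromRel fun x y : Λ => y = e.symm ((e x).1 + 1, (e x).2) ∨ y = e.symm ((e x).1, (e x).2 + 1)) 1 U; let Tw : ∀ (L M : ℕ) [NeZero L] [NeZero M] (Λ : Type) [LinearOrder Λ] [Fintype Λ], (Λ ≃ ZMod L × ZMod M) → ℝ → Matrix (Finset (Orb Λ)) (Finset (Orb Λ)) ℂ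 := fun _ M _ _ _ _ _ e θ => ∑ b : ZMod M, ∑ σ : Fin 2, ((1 - Complex.exp (Complex.I * θ)) • (creation (orb (e.symm (0, b)) σ) * annihilation (orb (e.symm (-1, b)) σ)) + (1 - Complex.exp (-(Complex.I * θ))) • (creation (orb (e.symm (-1, b)) σ) * annihilation (orb (e.symm (0, b)) σ))); let E : ∀ (L M : ℕ) [NeZero L] [NeZero M] (Λ : Type) [LinearOrder Λ] [Fintype Λ], (Λ ≃ ZMod L × ZMod M) → ℝ → ℝ → ℕ → ℝ := fun L M _ _ Λ _ _ e U θ N => (H0 L M Λ e U + Tw L M Λ e θ).minEnergyOn (szSector N 0); let Np : ℕ → ℕ → ℝ → ℕ := fun L M δ => 2 * ⌊(1 - δ) * ((L : ℝ) * (M : ℝ)) / 2⌋₊; let stiff : ∀ (L M : ℕ) [NeZero L] [NeZero M] (Λ : Type) [LinearOrder Λ] [Fintype Λ], (Λ ≃ ZMod L × ZMod M) → ℝ → ℝ → ℝ := fun L M _ _ Λ _ _ e U δ => 2 * (L : ℝ) * (E L M Λ e U (Real.pi / 3) (Np L M δ) - E L M Λ e U 0 (Np L M δ)) / ((Real.pi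 / 3) ^ 2 * (M : ℝ)); let icomp : ∀ (L M : ℕ) [NeZero L] [NeZero M] (Λ : Type) [LinearOrder Λ] [Fintype Λ], (Λ ≃ ZMod L × ZMod M) → ℝ → ℝ → ℝ := fun L M _ _ Λ _ _ e U δ => (L : ℝ) * (M : ℝ) * (E L M Λ e U 0 (Np L M δ + 2) + E L M Λ e U 0 (Np L M δ - 2) - 2 * E L M Λ e U 0 (Np L M δ)) / 4; ∀ (L M : ℕ) [NeZero L] [NeZero M], Even L → Even M → M₁ ≤ M → M ≤ L → L₀ ≤ L → ∀ (Λ : Type) [LinearOrder Λ] [Fintype Λ] (e : Λ ≃ ZMod L × ZMod M), d₀ ≤ stiff L M Λ e U δ ∧ 0 < icomp L M Λ e U δ ∧ icomp L M Λ e U δ ≤ k₀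

/-- FACTOR T at one width `M` — EQUAL-COLUMN WEIGHT: for every even `L ≥ L₁` with `M ≤ L`, every labelling and every
normalised `(N_{L,M}, S^z = 0)` sector ground state `ψ`, the `r = 0` column correlator `G_ψ(0) = Σ_a ‖Φ_a ψ‖²` is at least
`A₀ · L · M²` (same `let`s as the crux; only the last clause differs). -/
def ColumnWeight (U δ : ℝ) (M : ℕ) (A₀ : ℝ) (L₁ : ℕ) : Prop :=
  open Matrix Literature.MathematicalPhysics.QuantumLattice in let H0 : ∀ (L M : ℕ) (Λ : Type) [LinearOrder Λ] [Fintype Λ], (Λ ≃ ZMod L × ZMod M) → ℝ → Matrix (Finset (Orb Λ)) (Finset (Orb Λ)) ℂ := fun _ _ Λ _ _ e U => hamiltonian (SimpleGraph.fromRel fun x y : Λ => y = e.symm ((e x).1 + 1, (e x).2) ∨ y = e.symm ((e x).1, (e x).2 + 1)) 1 U; let Tw : ∀ (L M : ℕ) [NeZero L] [NeZero M] (Λ : Type) [LinearOrder Λ] [Fintype Λ], (Λ ≃ ZMod L × ZMod M) → ℝ → Matrix (Finset (Orb Λ)) (Finset (Orb Λ)) ℂ := fun _ M _ _ _ _ _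 e θ => ∑ b : ZMod M, ∑ σ : Fin 2, ((1 - Complex.exp (Complex.I * θ)) • (creation (orb (e.symm (0, b)) σ) * annihilation (orb (e.symm (-1, b)) σ)) + (1 - Complex.exp (-(Complex.I * θ))) • (creation (orb (e.symm (-1, b)) σ) * annihilation (orb (e.symm (0, b)) σ))); let E : ∀ (L M : ℕ) [NeZero L] [NeZero M] (Λ : Type) [LinearOrder Λ] [Fintype Λ], (Λ ≃ ZMod L × ZMod M) → ℝ → ℝ → ℕ → ℝ := fun L M _ _ Λ _ _ e U θ N => (H0 L M Λ e U + Tw L M Λ e θ).minEnergyOn (szSector N 0); let Np : ℕ → ℕ → ℝ → ℕ := fun L M δ => 2 * ⌊(1 - δ) * ((L : ℝ) * (M : ℝ)) / 2⌋₊; let stiff : ∀ (L M : ℕ) [NeZero L] [NeZero M] (Λ : Type) [LinearOrder Λ] [Fintype Λ], (Λ ≃ ZMod L × ZMod M) → ℝ → ℝ → ℝ := fun L M _ _ Λ _ _ e U δ => 2 * (L : ℝ) * (E L M Λ e U (Real.pi / 3) (Np L M δ) - E L M Λ e U 0 (Np L M δ)) / ((Real.pi / 3) ^ 2 * (M : ℝ));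 let icomp : ∀ (L M : ℕ) [NeZero L] [NeZero M] (Λ : Type) [LinearOrder Λ] [Fintype Λ], (Λ ≃ ZMod L × ZMod M) → ℝ → ℝ → ℝ := fun L M _ _ Λ _ _ e U δ => (L : ℝ) * (M : ℝ) * (E L M Λ e U 0 (Np L M δ + 2) + E L M Λ e U 0 (Np L M δ - 2) - 2 * E L M Λ e U 0 (Np L M δ)) / 4; let P : ∀ (L M : ℕ) (Λ : Type) [LinearOrder Λ] [Fintype Λ], (Λ ≃ ZMod L × ZMod M) → Λ → Matrix (Finset (Orb Λ)) (Finset (Orb Λ)) ℂ := fun _ _ Λ _ _ e x => ∑ j : Fin 4, (((![1, 1, -1, -1] : Fin 4 → ℝ) j / Real.sqrt 2 : ℝ) : ℂ) • (annihilation (orb x 0) * annihilation (orb ((![e.symm ((e x).1 + 1, (e x).2), e.symm ((e x).1 - 1, (e x).2), e.symm ((e x).1, (e x).2 + 1), e.symm ((e x).1, (e x).2 - 1)] : Fin 4 → Λ) j) 1) - annihilation (orb x 1) * annihilation (orb ((![e.symm ((e x).1 + 1, (e x).2), e.symm ((e x).1 - 1, (e x).2), e.symm ((e x).1, (e x).2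 + 1), e.symm ((e x).1, (e x).2 - 1)] : Fin 4 → Λ) j) 0)); let G : ∀ (L M : ℕ) [NeZero L] [NeZero M] (Λ : Type) [LinearOrder Λ] [Fintype Λ], (Λ ≃ ZMod L × ZMod M) → Fock (Orb Λ) → ZMod L → ℝ := fun L M _ _ Λ _ _ e ψ r => ∑ a : ZMod L, (expect ((∑ b : ZMod M, P L M Λ e (e.symm (a, b)))ᴴ * (∑ b : ZMod M, P L M Λ e (e.symm (a + r, b)))) ψ).re; ∀ (L : ℕ) [NeZero L] [NeZero M], Even L → M ≤ L → L₁ ≤ L → ∀ (Λ : Type) [LinearOrder Λ] [Fintype Λ] (e : Λ ≃ ZMod L × ZMod M), ∀ ψ : Fock (Orb Λ), star ψ ⬝ᵥ ψ = 1 → IsGroundStateInSector (H0 L M Λ e U) (Np L M δ) 0 ψ → A₀ * (L : ℝ) * (M : ℝ) ^ 2 ≤ G L M Λ e ψ 0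

/-- FACTOR L at one width `M` — AMPLITUDE-FREE HALDANE-FORM LAW: for every even `L ≥ L₁` with `M ≤ L`, every labelling,
every normalised sector ground state `ψ` and every long-cycle displacement `r` with `R ≤ r̂ = min(r, L − r)`:
`a · G_ψ(0) · r̂^{−Ξ√(ẽ″_{L,M}/ρ̃_{L,M})/M} ≤ G_ψ(r)` (the crux's law with the absolute amplitude `A·L·M²` replaced by the
state's own equal-column weight `a·G_ψ(0)`). -/
def RelativeLaw (U δ : ℝ) (M : ℕ) (Ξ a : ℝ) (R L₁ : ℕ) : Prop :=
  open Matrix Literature.MathematicalPhysics.QuantumLattice in let H0 : ∀ (L M : ℕ) (Λ : Type) [LinearOrder Λ] [Fintype Λ], (Λ ≃ ZMod L × ZMod M) → ℝ → Matrix (Finset (Orb Λ)) (Finset (Orb Λ)) ℂ := fun _ _ Λ _ _ e U => hamiltonian (SimpleGraph.fromRel fun x y : Λ => y = e.symm ((e x).1 + 1, (e x).2) ∨ y = e.symm ((e x).1, (e x).2 + 1)) 1 U; let Tw : ∀ (L M : ℕ) [NeZero L] [NeZero M] (Λ : Type) [LinearOrder Λ] [Fintype Λ], (Λ ≃ ZMod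 L × ZMod M) → ℝ → Matrix (Finset (Orb Λ)) (Finset (Orb Λ)) ℂ := fun _ M _ _ _ _ _ e θ => ∑ b : ZMod M, ∑ σ : Fin 2, ((1 - Complex.exp (Complex.I * θ)) • (creation (orb (e.symm (0, b)) σ) * annihilation (orb (e.symm (-1, b)) σ)) + (1 - Complex.exp (-(Complex.I * θ))) • (creation (orb (e.symm (-1, b)) σ) * annihilation (orb (e.symm (0, b)) σ))); let E : ∀ (L M : ℕ) [NeZero L] [NeZero M] (Λ : Type) [LinearOrder Λ] [Fintype Λ], (Λ ≃ ZMod L × ZMod M) → ℝ → ℝ → ℕ → ℝ := fun L M _ _ Λ _ _ e U θ N => (H0 L M Λ e U + Tw L M Λ e θ).minEnergyOn (szSector N 0); let Np : ℕ → ℕ → ℝ → ℕ := fun L M δ => 2 * ⌊(1 - δ) * ((L : ℝ) * (M : ℝ)) / 2⌋₊; let stiff : ∀ (L M : ℕ) [NeZero L] [NeZero M] (Λ : Type) [LinearOrder Λ] [Fintype Λ], (Λ ≃ ZMod L × ZMod M) → ℝ → ℝ → ℝ := fun L M _ _ Λ _ _ e U δ => 2 * (L : ℝ) * (E L M Λ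 e U (Real.pi / 3) (Np L M δ) - E L M Λ e U 0 (Np L M δ)) / ((Real.pi / 3) ^ 2 * (M : ℝ)); let icomp : ∀ (L M : ℕ) [NeZero L] [NeZero M] (Λ : Type) [LinearOrder Λ] [Fintype Λ], (Λ ≃ ZMod L × ZMod M) → ℝ → ℝ → ℝ := fun L M _ _ Λ _ _ e U δ => (L : ℝ) * (M : ℝ) * (E L M Λ e U 0 (Np L M δ + 2) + E L M Λ e U 0 (Np L M δ - 2) - 2 * E L M Λ e U 0 (Np L M δ)) / 4; let P : ∀ (L M : ℕ) (Λ : Type) [LinearOrder Λ] [Fintype Λ], (Λ ≃ ZMod L × ZMod M) → Λ → Matrix (Finset (Orb Λ)) (Finset (Orb Λ)) ℂ := fun _ _ Λ _ _ e x => ∑ j : Fin 4, (((![1, 1, -1, -1] : Fin 4 → ℝ) j / Real.sqrt 2 : ℝ) : ℂ) • (annihilation (orb x 0) * annihilation (orb ((![e.symm ((e x).1 + 1, (e x).2), e.symm ((e x).1 - 1, (e x).2), e.symm ((e x).1, (e x).2 + 1), e.symm ((e x).1, (e x).2 - 1)] : Fin 4 → Λ) j) 1) - annihilation (orb x 1)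 * annihilation (orb ((![e.symm ((e x).1 + 1, (e x).2), e.symm ((e x).1 - 1, (e x).2), e.symm ((e x).1, (e x).2 + 1), e.symm ((e x).1, (e x).2 - 1)] : Fin 4 → Λ) j) 0)); let G : ∀ (L M : ℕ) [NeZero L] [NeZero M] (Λ : Type) [LinearOrder Λ] [Fintype Λ], (Λ ≃ ZMod L × ZMod M) → Fock (Orb Λ) → ZMod L → ℝ := fun L M _ _ Λ _ _ e ψ r => ∑ a : ZMod L, (expect ((∑ b : ZMod M, P L M Λ e (e.symm (a, b)))ᴴ * (∑ b : ZMod M, P L M Λ e (e.symm (a + r, b)))) ψ).re; ∀ (L : ℕ) [NeZero L] [NeZero M], Even L → M ≤ L → L₁ ≤ L → ∀ (Λ : Type) [LinearOrder Λ] [Fintype Λ] (e : Λ ≃ ZMod L × ZMod M), ∀ ψ : Fock (Orb Λ), star ψ ⬝ᵥ ψ = 1 → IsGroundStateInSector (H0 L M Λ e U) (Np L M δ) 0 ψ → ∀ r : ZMod L, R ≤ r.val → r.val + R ≤ L → a * G L M Λ e ψ 0 * ((min r.val (L - r.val) : ℕ) : ℝ) ^ (-(Ξ * Real.sqrt (icomp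 L M Λ e U δ / stiff L M Λ e U δ) / (M : ℝ))) ≤ G L M Λ e ψ r

/-! ## Stubs (the only `sorry`s of this file) -/

/-- STUB T — TRANSVERSE PAIR COHERENCE AT EQUAL COLUMN, width-uniform weight (`Σ_a ‖Φ_a ψ‖² ≥ A₀·L·M²`).
[LinBalentsFisher1997, NoackWhiteScalapino1996, DolfiEtAl2015, ArrigoniFradkinKivelson2004] -/
theorem stub_transverseCoherence :
    ∀ U : ℝ, 0 < U → ∀ δ ∈ Set.Ioo (0 : ℝ) (3 / 10), ∀ (d₀ k₀ : ℝ) (M₁ L₀ : ℕ), 0 < d₀ →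
      UniformThermo U δ d₀ k₀ M₁ L₀ →
        ∃ A₀ : ℝ, 0 < A₀ ∧ ∃ M₂ L₁ : ℕ, ∀ M : ℕ, Even M → M₂ ≤ M → ColumnWeight U δ M A₀ L₁ := by
  sorry

/-- STUB L — AMPLITUDE-FREE LUTHER–EMERY / HALDANE LAW for the normalised column correlator (`Ξ = 1 > 2/π` expected
universal; `a` relative O(1) constant; thresholds `R, L₁`; width floor `M₂`).
[Haldane1981, BenfattoFalcoMastropietro2010, BenfattoMastropietro2011, Mastropietro2005, DolfiEtAl2015] -/
theorem stub_relativeColumnLaw :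
    ∀ U : ℝ, 0 < U → ∀ δ ∈ Set.Ioo (0 : ℝ) (3 / 10), ∀ (d₀ k₀ : ℝ) (M₁ L₀ : ℕ), 0 < d₀ →
      UniformThermo U δ d₀ k₀ M₁ L₀ →
        ∃ Ξ : ℝ, 0 < Ξ ∧ ∃ a : ℝ, 0 < a ∧ ∃ R M₂ L₁ : ℕ, ∀ M : ℕ, Even M → M₂ ≤ M → RelativeLaw U δ M Ξ a R L₁ := by
  sorry

/-! ## The seam (real arithmetic, matched against the ζ-expanded statements by unification) -/

/-- `A₀·L·M² ≤ G(0)` and `a·G(0)·x ≤ G(r)` with `a, x ≥ 0` give `(a·A₀)·L·M²·x ≤ G(r)`. -/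
theorem core_factor {a A₀ Lr Msq x G0 Gr : ℝ}
    (h0 : A₀ * Lr * Msq ≤ G0) (h1 : a * G0 * x ≤ Gr) (ha : 0 ≤ a) (hx : 0 ≤ x) :
    a * A₀ * Lr * Msq * x ≤ Gr := by
  have h2 : a * A₀ * Lr * Msq * x = a * (A₀ * Lr * Msq) * x := by ring
  rw [h2]
  exact (mul_le_mul_of_nonneg_right (mul_le_mul_of_nonneg_left h0 ha) hx).trans h1

/-! ## The crux, verbatim, from the two stub statements; then BY NAME from the two stubs -/

/-- THE FACTORISATION, closed form (kernel-checked, no `sorry`): the two stub statements imply the crux — written out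
VERBATIM (the route decl's signature, character for character), so that only `WidthHaldaneBridge_of` below concludes the
route decl BY NAME; the `example`s after it certify that this verbatim statement IS the route decl of BOTH routes wanting
the item (`WidthHaldane.WidthHaldaneBridge`, `SeamInduction.WidthHaldaneBridge`; δ/ζ-unfolding only). -/
theorem WidthHaldaneBridge_of_stubs
    (hT : ∀ U : ℝ, 0 < U → ∀ δ ∈ Set.Ioo (0 : ℝ) (3 / 10), ∀ (d₀ k₀ : ℝ) (M₁ L₀ : ℕ), 0 < d₀ →
      UniformThermo U δ d₀ k₀ M₁ L₀ →
        ∃ A₀ : ℝ, 0 < A₀ ∧ ∃ M₂ L₁ : ℕ, ∀ M : ℕ, Even M → M₂ ≤ M → ColumnWeight U δ M A₀ L₁)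
    (hL : ∀ U : ℝ, 0 < U → ∀ δ ∈ Set.Ioo (0 : ℝ) (3 / 10), ∀ (d₀ k₀ : ℝ) (M₁ L₀ : ℕ), 0 < d₀ →
      UniformThermo U δ d₀ k₀ M₁ L₀ →
        ∃ Ξ : ℝ, 0 < Ξ ∧ ∃ a : ℝ, 0 < a ∧ ∃ R M₂ L₁ : ℕ, ∀ M : ℕ, Even M → M₂ ≤ M → RelativeLaw U δ M Ξ a R L₁) :
    open Matrix Literature.MathematicalPhysics.QuantumLattice in let H0 : ∀ (L M : ℕ) (Λ : Type) [LinearOrder Λ] [Fintype Λ], (Λ ≃ ZMod L × ZMod M) → ℝ → Matrix (Finset (Orb Λ)) (Finset (Orb Λ)) ℂ := fun _ _ Λ _ _ e U => hamiltonian (SimpleGraph.fromRel fun x y : Λ => y = e.symm ((e x).1 + 1, (e x).2) ∨ y = e.symm ((e x).1, (e x).2 + 1)) 1 U; let Tw : ∀ (L M : ℕ) [NeZero L] [NeZero M] (Λ : Type) [LinearOrder Λ] [Fintype Λ], (Λ ≃ ZMod L × ZMod M) → ℝ → Matrix (Finset (Orb Λ)) (Finset (Orb Λ)) ℂ := fun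 _ M _ _ _ _ _ e θ => ∑ b : ZMod M, ∑ σ : Fin 2, ((1 - Complex.exp (Complex.I * θ)) • (creation (orb (e.symm (0, b)) σ) * annihilation (orb (e.symm (-1, b)) σ)) + (1 - Complex.exp (-(Complex.I * θ))) • (creation (orb (e.symm (-1, b)) σ) * annihilation (orb (e.symm (0, b)) σ))); let E : ∀ (L M : ℕ) [NeZero L] [NeZero M] (Λ : Type) [LinearOrder Λ] [Fintype Λ], (Λ ≃ ZMod L × ZMod M) → ℝ → ℝ → ℕ → ℝ := fun L M _ _ Λ _ _ e U θ N => (H0 L M Λ e U + Tw L M Λ e θ).minEnergyOn (szSector N 0); let Np : ℕ → ℕ → ℝ → ℕ := fun L M δ => 2 * ⌊(1 - δ) * ((L : ℝ) * (M : ℝ)) / 2⌋₊; let stiff : ∀ (L M : ℕ) [NeZero L] [NeZero M] (Λ : Type) [LinearOrder Λ] [Fintype Λ], (Λ ≃ ZMod L × ZMod M) → ℝ → ℝ → ℝ := fun L M _ _ Λ _ _ e U δ => 2 * (L : ℝ) * (E L M Λ e U (Real.pi / 3) (Np L M δ) - E L M Λ e U 0 (Np L M δ)) / ((Real.pi / 3)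 ^ 2 * (M : ℝ)); let icomp : ∀ (L M : ℕ) [NeZero L] [NeZero M] (Λ : Type) [LinearOrder Λ] [Fintype Λ], (Λ ≃ ZMod L × ZMod M) → ℝ → ℝ → ℝ := fun L M _ _ Λ _ _ e U δ => (L : ℝ) * (M : ℝ) * (E L M Λ e U 0 (Np L M δ + 2) + E L M Λ e U 0 (Np L M δ - 2) - 2 * E L M Λ e U 0 (Np L M δ)) / 4; let P : ∀ (L M : ℕ) (Λ : Type) [LinearOrder Λ] [Fintype Λ], (Λ ≃ ZMod L × ZMod M) → Λ → Matrix (Finset (Orb Λ)) (Finset (Orb Λ)) ℂ := fun _ _ Λ _ _ e x => ∑ j : Fin 4, (((![1, 1, -1, -1] : Fin 4 → ℝ) j / Real.sqrt 2 : ℝ) : ℂ) • (annihilation (orb x 0) * annihilation (orb ((![e.symm ((e x).1 + 1, (e x).2), e.symm ((e x).1 - 1, (e x).2), e.symm ((e x).1, (e x).2 + 1), e.symm ((e x).1, (e x).2 - 1)] : Fin 4 → Λ) j) 1) - annihilation (orb x 1) * annihilation (orb ((![e.symm ((e x).1 + 1, (e x).2), e.symm ((e x).1 - 1, (e x).2),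 e.symm ((e x).1, (e x).2 + 1), e.symm ((e x).1, (e x).2 - 1)] : Fin 4 → Λ) j) 0)); let G : ∀ (L M : ℕ) [NeZero L] [NeZero M] (Λ : Type) [LinearOrder Λ] [Fintype Λ], (Λ ≃ ZMod L × ZMod M) → Fock (Orb Λ) → ZMod L → ℝ := fun L M _ _ Λ _ _ e ψ r => ∑ a : ZMod L, (expect ((∑ b : ZMod M, P L M Λ e (e.symm (a, b)))ᴴ * (∑ b : ZMod M, P L M Λ e (e.symm (a + r, b)))) ψ).re; ∀ U : ℝ, 0 < U → ∀ δ ∈ Set.Ioo (0 : ℝ) (3 / 10), ∀ (d₀ k₀ : ℝ) (M₁ L₀ : ℕ), 0 < d₀ → (∀ (L M : ℕ) [NeZero L] [NeZero M], Even L → Even M → M₁ ≤ M → M ≤ L → L₀ ≤ L → ∀ (Λ : Type) [LinearOrder Λ] [Fintype Λ] (e : Λ ≃ ZMod L × ZMod M), d₀ ≤ stiff L M Λ e U δ ∧ 0 < icomp L M Λ e U δ ∧ icomp L M Λ e U δ ≤ k₀) → ∃ Ξ : ℝ, 0 < Ξ ∧ ∃ A : ℝ, 0 < A ∧ ∃ R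 M₂ L₁ : ℕ, ∀ (L M : ℕ) [NeZero L] [NeZero M], Even L → Even M → M₂ ≤ M → M ≤ L → L₁ ≤ L → ∀ (Λ : Type) [LinearOrder Λ] [Fintype Λ] (e : Λ ≃ ZMod L × ZMod M), ∀ ψ : Fock (Orb Λ), star ψ ⬝ᵥ ψ = 1 → IsGroundStateInSector (H0 L M Λ e U) (Np L M δ) 0 ψ → ∀ r : ZMod L, R ≤ r.val → r.val + R ≤ L → A * (L : ℝ) * (M : ℝ) ^ 2 * ((min r.val (L - r.val) : ℕ) : ℝ) ^ (-(Ξ * Real.sqrt (icomp L M Λ e U δ / stiff L M Λ e U δ) / (M : ℝ))) ≤ G L M Λ e ψ r := by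
  dsimp only
  intro U hU δ hδ d₀ k₀ M₁ L₀ hd₀ hth
  obtain ⟨A₀, hA₀, M₂, L₁, hTw⟩ :=
    hT U hU δ hδ d₀ k₀ M₁ L₀ hd₀ (by dsimp only [UniformThermo]; exact hth)
  obtain ⟨Ξ, hΞ, a, ha, R, M₂', L₁', hLw⟩ :=
    hL U hU δ hδ d₀ k₀ M₁ L₀ hd₀ (by dsimp only [UniformThermo]; exact hth)
  refine ⟨Ξ, hΞ, a * A₀, by positivity, R, max M₂ M₂', max L₁ L₁', ?_⟩
  intro L M _ _ hLe hMe hM hML hLL Λ _ _ e ψ hψ hGS r hr hrL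
  have hT1 := hTw M hMe (le_of_max_le_left hM)
  have hL1 := hLw M hMe (le_of_max_le_right hM)
  dsimp only [ColumnWeight] at hT1
  dsimp only [RelativeLaw] at hL1
  have h0 := hT1 L hLe hML (le_of_max_le_left hLL) Λ e ψ hψ hGS
  have h1 := hL1 L hLe hML (le_of_max_le_right hLL) Λ e ψ hψ hGS r hr hrL
  exact core_factor h0 h1 ha.le (Real.rpow_nonneg (Nat.cast_nonneg _) _)

/-- Certificate 1: the verbatim statement IS `WidthHaldane.WidthHaldaneBridge` (the item's registered crux decl). -/
example
    (hT : ∀ U : ℝ, 0 < U → ∀ δ ∈ Set.Ioo (0 : ℝ) (3 / 10), ∀ (d₀ k₀ : ℝ) (M₁ L₀ : ℕ), 0 < d₀ →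
      UniformThermo U δ d₀ k₀ M₁ L₀ →
        ∃ A₀ : ℝ, 0 < A₀ ∧ ∃ M₂ L₁ : ℕ, ∀ M : ℕ, Even M → M₂ ≤ M → ColumnWeight U δ M A₀ L₁)
    (hL : ∀ U : ℝ, 0 < U → ∀ δ ∈ Set.Ioo (0 : ℝ) (3 / 10), ∀ (d₀ k₀ : ℝ) (M₁ L₀ : ℕ), 0 < d₀ →
      UniformThermo U δ d₀ k₀ M₁ L₀ →
        ∃ Ξ : ℝ, 0 < Ξ ∧ ∃ a : ℝ, 0 < a ∧ ∃ R M₂ L₁ : ℕ, ∀ M : ℕ, Even M → M₂ ≤ M → RelativeLaw U δ M Ξ a R L₁) :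
    WidthHaldaneBridge :=
  WidthHaldaneBridge_of_stubs hT hL

/-- Certificate 2: … and IS `SeamInduction.WidthHaldaneBridge` (this strategist's route; the two decls are `rfl`-equal). -/
example
    (hT : ∀ U : ℝ, 0 < U → ∀ δ ∈ Set.Ioo (0 : ℝ) (3 / 10), ∀ (d₀ k₀ : ℝ) (M₁ L₀ : ℕ), 0 < d₀ →
      UniformThermo U δ d₀ k₀ M₁ L₀ →
        ∃ A₀ : ℝ, 0 < A₀ ∧ ∃ M₂ L₁ : ℕ, ∀ M : ℕ, Even M → M₂ ≤ M → ColumnWeight U δ M A₀ L₁)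
    (hL : ∀ U : ℝ, 0 < U → ∀ δ ∈ Set.Ioo (0 : ℝ) (3 / 10), ∀ (d₀ k₀ : ℝ) (M₁ L₀ : ℕ), 0 < d₀ →
      UniformThermo U δ d₀ k₀ M₁ L₀ →
        ∃ Ξ : ℝ, 0 < Ξ ∧ ∃ a : ℝ, 0 < a ∧ ∃ R M₂ L₁ : ℕ, ∀ M : ℕ, Even M → M₂ ≤ M → RelativeLaw U δ M Ξ a R L₁) :
    Summit.HubbardSuperconductivity.HubbardSuperconductivity.Theses.SeamInduction.WidthHaldaneBridge :=
  WidthHaldaneBridge_of_stubs hT hL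

/-- SKELETON THEOREM: the crux BY NAME from the two registered stubs (both open; `sorryAx` enters only through
`stub_transverseCoherence` and `stub_relativeColumnLaw`). -/
theorem WidthHaldaneBridge_of : WidthHaldaneBridge :=
  WidthHaldaneBridge_of_stubs stub_transverseCoherence stub_relativeColumnLaw

end Summit.HubbardSuperconductivity.HubbardSuperconductivity.Cruxes.WidthHaldaneBridge.ColumnFactorisation
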